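import Summits.HodgeConjecture.CorCM.Census.OcticTwistClosingDMoves

/-!
# The octic twist `(ℤ/8 × B, (4,0))`, XII: THE CLOSING MOVES (b) — nine residual classes give all the lifts and all the D-moves

COR-CM (cell `pub-hodgecm2`), count-neutral kernel combinatorics by the binder seat b09 (gen 33; lane COINVARIANT-TWIST / OCTIC RECON, design
step 4 = FACT 5 of `HOME/pub-hodgecm2-b09/lean-g33/COINVARIANT-TWIST.md`), on top of part XII (a) (`Census/OcticTwistClosingDMoves.lean`:
`diag_mem`, `swap_mem`, `tele_right`, `D0_mem`, `D1_mem`), parts I, VI (`pairVec₂`, `pairs₂`, `single_eq_tens`, `Wvec_eq_sum`, `tens_sum_left`,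
`ccSquare_mem`) and the quartic files (`QuarticTwistResidual`: `Xvec`, `Wvec`; `QuarticTwistGenerate`: `transl_Xvec`, `transl_Wvec`;
`QuarticTwistModel`: `pairVec`, `cst_add_two`, `atom_add_two`) BY NAME.  Theorems only; no definition, no certificate, no named fact, no `sorry`.
HONEST FRAMING: `HC_CM` is NOT proved; nothing here is a period or a headline.

WHAT.  Let `N₂` be a MOTION-STABLE submodule containing `pairs₂`.  The octic residual theorem (part IX) wants SIX families in `N₂`: the lifts
`X_{u,b} ⊗ e_{u′}`, `e_{u′} ⊗ X_{u,b}`, `w_u ⊗ e_{u′}`, `e_{u′} ⊗ w_u` and the D-moves of both kinds, for ALL parameters.  **`closing_moves`** derives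
all six from NINE classes — the exact residual reductions of the nine CLOSING FACES of the octic design (numerically they generate the residual
module over `ℤ` with index `1` for `B = ℤ/3, ℤ/5`, and no eight of them do):
* `hF1` (six): `(e_0 − e_1) ⊗ (e_Δ − e_{Δ + k δ_{b₁}})`, `Δ ∈ {0,1,2}`, `k = ±1` — the MIXED closing faces (part XII (a): all D-moves);
* `hF2` (one): `(X_{1,b₀} + pair(cst 0) − pair(atom(0,b₀,−1))) ⊗ e_0` — the COLUMN closing face (`QuarticTwistClosing.closing_column`) `⊗ e_0`;
* `hF3` (two): `(Σ_{q∈Q} X_{0,q} − w_1) ⊗ e_c`, `c ∈ {0,1}` — the EQUATORIAL closing face (`closing_square`) `⊗ e_c`.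
§3: the pair terms of `hF2` are a D-move modulo `pairs₂`, so `X_{1,b₀} ⊗ e_0 ∈ N₂`; `X ⊗ (e_0 − e_c)` is a sum of two D-moves; motions and the
swap-twist give all X-lifts.  §4: `hF3` and the X-lifts give `w_1 ⊗ e_0`, `w_1 ⊗ e_1`, hence `w_u ⊗ e_u`, `w_u ⊗ e_{u−1}`, hence (`ccSquare_mem`)
the squares `d ⊗ d` (`d = e_u − e_{u−1}`), by the swap-twist `d′ ⊗ d` for consecutive `d, d′`, then ALL `d_i ⊗ d_j` from
`(d_i + d_{i+1})^{⊗2} ∈ pairs₂` and `Σ_i d_i = 0`; telescoping gives `d ⊗ (e_u − e_c)`, whence `w_u ⊗ e_c` for every `c`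
(`w_u ⊗ (e_u − e_c) = Σ_b (e_{u−δ_b} − e_u) ⊗ (e_u − e_c) + d ⊗ (e_u − e_c)`), and the swap-twist again.  §5 assembles.

## References
* [Pohlmann1968] H. Pohlmann, Algebraic cycles on abelian varieties of complex multiplication type, Ann. of Math. 88 (1968), Thm 1.
-/

namespace Summit.HodgeConjecture.CorCM.Census.OcticTwist

open Finset
open Summit.HodgeConjecture.CorCM.Census.QuarticTwist

variable (B : Type) [AddGroup B] [Fintype B] [DecidableEq B]

/-! ## §3 The X-lifts from the column class -/

omit [AddGroup B] in
/-- The pair terms of the column class are a D-move modulo `pairs₂`: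
`(pair(cst 0) − pair(atom(0,b,−1))) ⊗ e_0 = pair₂(cst 2, cst 0) − pair₂(atom(2,b,−1), cst 0) − (e_{atom(0,b,−1)} − e_0) ⊗ (e_0 − e_2)`. [folklore] -/
theorem pairTerms_mem {N₂ : Submodule ℤ (Ty₂ B → ℤ)} (hP : pairs₂ B ≤ N₂)
    (hD0 : ∀ (u : ZMod 4) (b : B) (k : ZMod 4) (u' u'' : ZMod 4), (k = 1 ∨ k = -1) →
      tens B (Pi.single (atom B u b k) 1 - Pi.single (cst B u) 1) (Pi.single (cst B u') 1 - Pi.single (cst B u'') 1) ∈ N₂) (b : B) :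
    tens B (pairVec B (cst B 0) - pairVec B (atom B 0 b (-1))) (Pi.single (cst B 0) 1) ∈ N₂ := by
  have h22 : (2 : ZMod 4) + 2 = 0 := by decide
  have e : tens B (pairVec B (cst B 0) - pairVec B (atom B 0 b (-1))) (Pi.single (cst B 0) 1)
      = (pairVec₂ B (cst B 2, cst B 0) - pairVec₂ B (atom B 2 b (-1), cst B 0))
        - tens B (Pi.single (atom B 0 b (-1)) 1 - Pi.single (cst B 0) 1) (Pi.single (cst B 0) 1 - Pi.single (cst B 2) 1) := by
    unfold pairVec pairVec₂
    simp only [cst_add_two, atom_add_two, zero_add, h22]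
    rw [single_eq_tens B (cst B 2), single_eq_tens B (cst B 0) (cst B 2), single_eq_tens B (atom B 2 b (-1)),
      single_eq_tens B (atom B 0 b (-1)) (cst B 2), tens_sub_left, tens_add_left, tens_add_left, tens_sub_left, tens_sub_right, tens_sub_right]
    abel
  rw [e]
  exact Submodule.sub_mem _ (Submodule.sub_mem _ (hP (pairVec₂_mem_pairs₂ B _)) (hP (pairVec₂_mem_pairs₂ B _)))
    (hD0 0 b (-1) 0 2 (Or.inr rfl))

omit [AddGroup B] in
/-- **`X_{1,b₀} ⊗ e_0 ∈ N₂`** from the column class. [folklore] -/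
theorem X_base_mem {N₂ : Submodule ℤ (Ty₂ B → ℤ)} (hP : pairs₂ B ≤ N₂)
    (hD0 : ∀ (u : ZMod 4) (b : B) (k : ZMod 4) (u' u'' : ZMod 4), (k = 1 ∨ k = -1) →
      tens B (Pi.single (atom B u b k) 1 - Pi.single (cst B u) 1) (Pi.single (cst B u') 1 - Pi.single (cst B u'') 1) ∈ N₂) {b₀ : B}
    (hF2 : tens B (Xvec B 1 b₀ + pairVec B (cst B 0) - pairVec B (atom B 0 b₀ (-1))) (Pi.single (cst B 0) 1) ∈ N₂) :
    tens B (Xvec B 1 b₀) (Pi.single (cst B 0) 1) ∈ N₂ := by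
  have e : tens B (Xvec B 1 b₀) (Pi.single (cst B 0) 1) = tens B (Xvec B 1 b₀ + pairVec B (cst B 0) - pairVec B (atom B 0 b₀ (-1))) (Pi.single (cst B 0) 1)
      - tens B (pairVec B (cst B 0) - pairVec B (atom B 0 b₀ (-1))) (Pi.single (cst B 0) 1) := by
    rw [add_sub_assoc, tens_add_left, add_sub_cancel_right]
  rw [e]
  exact Submodule.sub_mem _ hF2 (pairTerms_mem B hP hD0 b₀)

omit [AddGroup B] in
/-- `X_{1,b₀} ⊗ e_c ∈ N₂` for every `c`: `X ⊗ (e_0 − e_c)` is a sum of two D-moves. [folklore] -/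
theorem X_col_mem {N₂ : Submodule ℤ (Ty₂ B → ℤ)}
    (hD0 : ∀ (u : ZMod 4) (b : B) (k : ZMod 4) (u' u'' : ZMod 4), (k = 1 ∨ k = -1) →
      tens B (Pi.single (atom B u b k) 1 - Pi.single (cst B u) 1) (Pi.single (cst B u') 1 - Pi.single (cst B u'') 1) ∈ N₂) {b₀ : B}
    (hX : tens B (Xvec B 1 b₀) (Pi.single (cst B 0) 1) ∈ N₂) (c : ZMod 4) : tens B (Xvec B 1 b₀) (Pi.single (cst B c) 1) ∈ N₂ := by
  have e : tens B (Xvec B 1 b₀) (Pi.single (cst B c) 1)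
      = tens B (Xvec B 1 b₀) (Pi.single (cst B 0) 1) - tens B (Xvec B 1 b₀) (Pi.single (cst B 0) 1 - Pi.single (cst B c) 1) := by
    rw [tens_sub_right, sub_sub_cancel]
  have e2 : tens B (Xvec B 1 b₀) (Pi.single (cst B 0) 1 - Pi.single (cst B c) 1)
      = tens B (Pi.single (atom B 1 b₀ 1) 1 - Pi.single (cst B 1) 1) (Pi.single (cst B 0) 1 - Pi.single (cst B c) 1)
        + tens B (Pi.single (atom B 2 b₀ (-1)) 1 - Pi.single (cst B 2) 1) (Pi.single (cst B 0) 1 - Pi.single (cst B c) 1) := by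
    rw [← tens_add_left]
    unfold Xvec
    rw [show (1 : ZMod 4) + 1 = 2 by norm_num]
    congr 1
    abel
  rw [e, e2]
  exact Submodule.sub_mem _ hX (Submodule.add_mem _ (hD0 1 b₀ 1 0 c (Or.inl rfl)) (hD0 2 b₀ (-1) 0 c (Or.inr rfl)))

/-- **All X-lifts of the first kind** `X_{u,b} ⊗ e_{u′} ∈ N₂`, by the motions. [folklore] -/
theorem X0_mem {N₂ : Submodule ℤ (Ty₂ B → ℤ)} (hmot : ∀ v ∈ N₂, ∀ (e : Bool) (h : ZMod 4 × B), transl₂ B e h v ∈ N₂) {b₀ : B}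
    (hX : ∀ c : ZMod 4, tens B (Xvec B 1 b₀) (Pi.single (cst B c) 1) ∈ N₂) (u : ZMod 4) (b : B) (u' : ZMod 4) :
    tens B (Xvec B u b) (Pi.single (cst B u') 1) ∈ N₂ := by
  have e1 : transl B (u - 1, -b + b₀) (Xvec B 1 b₀) = Xvec B u b := by
    rw [transl_Xvec]
    show Xvec B (1 + (u - 1)) (b₀ - (-b + b₀)) = Xvec B u b
    rw [add_sub_cancel, sub_neg_add_self]
  have h := diag_mem B hmot (hX (u' - (u - 1))) (u - 1, -b + b₀)
  rwa [e1, transl_single_cst, sub_add_cancel] at h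

/-- **All X-lifts of the second kind** `e_{u′} ⊗ X_{u,b} ∈ N₂`, by the swap-twist. [folklore] -/
theorem X1_mem {N₂ : Submodule ℤ (Ty₂ B → ℤ)} (hmot : ∀ v ∈ N₂, ∀ (e : Bool) (h : ZMod 4 × B), transl₂ B e h v ∈ N₂)
    (hX0 : ∀ (u : ZMod 4) (b : B) (u' : ZMod 4), tens B (Xvec B u b) (Pi.single (cst B u') 1) ∈ N₂) (u : ZMod 4) (b : B) (u' : ZMod 4) :
    tens B (Pi.single (cst B u') 1) (Xvec B u b) ∈ N₂ := by
  have h := swap_mem B hmot (hX0 u b (u' - 1))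
  rwa [transl_single_cst, sub_add_cancel] at h

/-! ## §4 The Weil lifts from the two equatorial classes -/

omit [AddGroup B] in
/-- `w_1 ⊗ e_c ∈ N₂` for `c ∈ {0,1}` from the equatorial classes and the X-lifts. [folklore] -/
theorem W_base_mem {N₂ : Submodule ℤ (Ty₂ B → ℤ)}
    (hX0 : ∀ (u : ZMod 4) (b : B) (u' : ZMod 4), tens B (Xvec B u b) (Pi.single (cst B u') 1) ∈ N₂) {Q : Finset B} {c : ZMod 4}
    (hF3 : tens B ((∑ q ∈ Q, Xvec B 0 q) - Wvec B 1) (Pi.single (cst B c) 1) ∈ N₂) : tens B (Wvec B 1) (Pi.single (cst B c) 1) ∈ N₂ := by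
  have e : tens B (Wvec B 1) (Pi.single (cst B c) 1)
      = tens B (∑ q ∈ Q, Xvec B 0 q) (Pi.single (cst B c) 1) - tens B ((∑ q ∈ Q, Xvec B 0 q) - Wvec B 1) (Pi.single (cst B c) 1) := by
    rw [tens_sub_left, sub_sub_cancel]
  rw [e, tens_sum_left]
  exact Submodule.sub_mem _ (Submodule.sum_mem _ fun q _ => hX0 0 q c) hF3

/-- `w_u ⊗ e_u` and `w_u ⊗ e_{u−1}` for every `u`, by the motions. [folklore] -/
theorem W_diag_mem {N₂ : Submodule ℤ (Ty₂ B → ℤ)} (hmot : ∀ v ∈ N₂, ∀ (e : Bool) (h : ZMod 4 × B), transl₂ B e h v ∈ N₂)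
    (h0 : tens B (Wvec B 1) (Pi.single (cst B 0) 1) ∈ N₂) (h1 : tens B (Wvec B 1) (Pi.single (cst B 1) 1) ∈ N₂) (u : ZMod 4) :
    tens B (Wvec B u) (Pi.single (cst B u) 1) ∈ N₂ ∧ tens B (Wvec B u) (Pi.single (cst B (u - 1)) 1) ∈ N₂ := by
  have k1 := diag_mem B hmot h1 (u - 1, (0 : B))
  have k0 := diag_mem B hmot h0 (u - 1, (0 : B))
  rw [transl_Wvec, transl_single_cst, add_sub_cancel] at k1
  rw [transl_Wvec, transl_single_cst, add_sub_cancel, zero_add] at k0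
  exact ⟨k1, k0⟩

/-- The squares `(e_u − e_{u−1}) ⊗ (e_u − e_{u−1})` (`ccSquare_mem`) and, by the swap-twist, `(e_{u+1} − e_u) ⊗ (e_u − e_{u−1})`. [folklore] -/
theorem ZY_mem {N₂ : Submodule ℤ (Ty₂ B → ℤ)} (hmot : ∀ v ∈ N₂, ∀ (e : Bool) (h : ZMod 4 × B), transl₂ B e h v ∈ N₂)
    (hD0 : ∀ (u : ZMod 4) (b : B) (k : ZMod 4) (u' u'' : ZMod 4), (k = 1 ∨ k = -1) →
      tens B (Pi.single (atom B u b k) 1 - Pi.single (cst B u) 1) (Pi.single (cst B u') 1 - Pi.single (cst B u'') 1) ∈ N₂)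
    (hW : ∀ u : ZMod 4, tens B (Wvec B u) (Pi.single (cst B u) 1) ∈ N₂ ∧ tens B (Wvec B u) (Pi.single (cst B (u - 1)) 1) ∈ N₂) (u : ZMod 4) :
    tens B (Pi.single (cst B u) 1 - Pi.single (cst B (u - 1)) 1) (Pi.single (cst B u) 1 - Pi.single (cst B (u - 1)) 1) ∈ N₂ ∧
      tens B (Pi.single (cst B (u + 1)) 1 - Pi.single (cst B u) 1) (Pi.single (cst B u) 1 - Pi.single (cst B (u - 1)) 1) ∈ N₂ := by
  have hZ : tens B (Pi.single (cst B u) 1 - Pi.single (cst B (u - 1)) 1) (Pi.single (cst B u) 1 - Pi.single (cst B (u - 1)) 1) ∈ N₂ :=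
    ccSquare_mem B u u (u - 1) (hW u).1 (hW u).2 (fun b => hD0 u b (-1) u (u - 1) (Or.inr rfl))
  refine ⟨hZ, ?_⟩
  have h := swap_mem B hmot hZ
  rwa [transl_sub, transl_single_cst, transl_single_cst, sub_add_cancel] at h

omit [AddGroup B] [DecidableEq B] in
/-- `(e_{u+1} − e_{u−1})^{⊗2} = pair₂(cst(u−1), cst(u−1)) − pair₂(cst(u−1), cst(u+1)) ∈ pairs₂`. [folklore] -/
theorem skipSquare_mem_pairs₂ (u : ZMod 4) :
    tens B (Pi.single (cst B (u + 1)) 1 - Pi.single (cst B (u - 1)) 1) (Pi.single (cst B (u + 1)) 1 - Pi.single (cst B (u - 1)) 1) ∈ pairs₂ B := by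
  have e3 : u - 1 + 2 = u + 1 := by ring
  have e5 : u + 1 + 2 = u - 1 := by
    rw [add_assoc, show (1 : ZMod 4) + 2 = -1 by decide, ← sub_eq_add_neg]
  have e : tens B (Pi.single (cst B (u + 1)) 1 - Pi.single (cst B (u - 1)) 1) (Pi.single (cst B (u + 1)) 1 - Pi.single (cst B (u - 1)) 1)
      = pairVec₂ B (cst B (u - 1), cst B (u - 1)) - pairVec₂ B (cst B (u - 1), cst B (u + 1)) := by
    unfold pairVec₂
    simp only [cst_add_two, e3, e5]
    rw [single_eq_tens B (cst B (u - 1)) (cst B (u - 1)), single_eq_tens B (cst B (u + 1)) (cst B (u + 1)),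
      single_eq_tens B (cst B (u - 1)) (cst B (u + 1)), single_eq_tens B (cst B (u + 1)) (cst B (u - 1)),
      tens_sub_left, tens_sub_right, tens_sub_right]
    abel
  rw [e]
  exact Submodule.sub_mem _ (pairVec₂_mem_pairs₂ B _) (pairVec₂_mem_pairs₂ B _)

omit [AddGroup B] [DecidableEq B] in
/-- **All squares of consecutive differences** `(e_{v+1} − e_v) ⊗ (e_{j+1} − e_j) ∈ N₂`: the classes `j − v = 0, −1` are `ZY_mem`; `j − v = 1` from
`(d_v + d_{v+1})^{⊗2} ∈ pairs₂`; `j − v = 2` from `Σ_i d_i = 0`. [folklore] -/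
theorem dd_mem {N₂ : Submodule ℤ (Ty₂ B → ℤ)} (hP : pairs₂ B ≤ N₂)
    (hZY : ∀ u : ZMod 4,
      tens B (Pi.single (cst B u) 1 - Pi.single (cst B (u - 1)) 1) (Pi.single (cst B u) 1 - Pi.single (cst B (u - 1)) 1) ∈ N₂ ∧
        tens B (Pi.single (cst B (u + 1)) 1 - Pi.single (cst B u) 1) (Pi.single (cst B u) 1 - Pi.single (cst B (u - 1)) 1) ∈ N₂)
    (v j : ZMod 4) : tens B (Pi.single (cst B (v + 1)) 1 - Pi.single (cst B v) 1) (Pi.single (cst B (j + 1)) 1 - Pi.single (cst B j) 1) ∈ N₂ := by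
  -- `Z v' = d_{v'-1} ⊗ d_{v'-1}`, `Y v' = d_{v'} ⊗ d_{v'-1}` with `d_i = e_{i+1} − e_i`
  have Z : ∀ i : ZMod 4, tens B (Pi.single (cst B (i + 1)) 1 - Pi.single (cst B i) 1) (Pi.single (cst B (i + 1)) 1 - Pi.single (cst B i) 1) ∈ N₂ := by
    intro i
    have := (hZY (i + 1)).1
    rwa [add_sub_cancel_right] at this
  have Y : ∀ i : ZMod 4, tens B (Pi.single (cst B (i + 1 + 1)) 1 - Pi.single (cst B (i + 1)) 1) (Pi.single (cst B (i + 1)) 1 - Pi.single (cst B i) 1) ∈ N₂ := by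
    intro i
    have := (hZY (i + 1)).2
    rwa [add_sub_cancel_right] at this
  -- `U i = d_i ⊗ d_{i+1} = (d_i + d_{i+1})^{⊗2} − Z(i+1) − Y i − Z i`
  have U : ∀ i : ZMod 4, tens B (Pi.single (cst B (i + 1)) 1 - Pi.single (cst B i) 1) (Pi.single (cst B (i + 1 + 1)) 1 - Pi.single (cst B (i + 1)) 1) ∈ N₂ := by
    intro i
    have hsq := hP (skipSquare_mem_pairs₂ B (i + 1))
    rw [add_sub_cancel_right] at hsq
    have e : tens B (Pi.single (cst B (i + 1)) 1 - Pi.single (cst B i) 1) (Pi.single (cst B (i + 1 + 1)) 1 - Pi.single (cst B (i + 1)) 1)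
        = tens B (Pi.single (cst B (i + 1 + 1)) 1 - Pi.single (cst B i) 1) (Pi.single (cst B (i + 1 + 1)) 1 - Pi.single (cst B i) 1)
          - tens B (Pi.single (cst B (i + 1 + 1)) 1 - Pi.single (cst B (i + 1)) 1) (Pi.single (cst B (i + 1 + 1)) 1 - Pi.single (cst B (i + 1)) 1)
          - tens B (Pi.single (cst B (i + 1 + 1)) 1 - Pi.single (cst B (i + 1)) 1) (Pi.single (cst B (i + 1)) 1 - Pi.single (cst B i) 1)
          - tens B (Pi.single (cst B (i + 1)) 1 - Pi.single (cst B i) 1) (Pi.single (cst B (i + 1)) 1 - Pi.single (cst B i) 1) := by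
      have split : (Pi.single (cst B (i + 1 + 1)) 1 - Pi.single (cst B i) 1 : Ty B → ℤ)
          = (Pi.single (cst B (i + 1 + 1)) 1 - Pi.single (cst B (i + 1)) 1) + (Pi.single (cst B (i + 1)) 1 - Pi.single (cst B i) 1) := by
        rw [sub_add_sub_cancel]
      rw [split, tens_add_left, tens_add_right, tens_add_right]
      abel
    rw [e]
    exact Submodule.sub_mem _ (Submodule.sub_mem _ (Submodule.sub_mem _ hsq (Z (i + 1))) (Y i)) (Z i)
  -- `V i = d_i ⊗ d_{i+2} = −(d_i ⊗ d_{i-1} + Z i + U i)` since `d_{i-1} + d_i + d_{i+1} + d_{i+2} = 0`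
  have V : ∀ i : ZMod 4, tens B (Pi.single (cst B (i + 1)) 1 - Pi.single (cst B i) 1)
      (Pi.single (cst B (i + 1 + 1 + 1)) 1 - Pi.single (cst B (i + 1 + 1)) 1) ∈ N₂ := by
    intro i
    have hY := Y (i - 1)
    rw [sub_add_cancel] at hY
    have e4 : i + 1 + 1 + 1 + 1 = i := by
      rw [add_assoc, add_assoc, add_assoc, show (1 : ZMod 4) + (1 + (1 + 1)) = 0 by decide, add_zero]
    have cyc : tens B (Pi.single (cst B (i + 1)) 1 - Pi.single (cst B i) 1) (Pi.single (cst B i) 1 - Pi.single (cst B (i - 1)) 1)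
        + tens B (Pi.single (cst B (i + 1)) 1 - Pi.single (cst B i) 1) (Pi.single (cst B (i + 1)) 1 - Pi.single (cst B i) 1)
        + tens B (Pi.single (cst B (i + 1)) 1 - Pi.single (cst B i) 1) (Pi.single (cst B (i + 1 + 1)) 1 - Pi.single (cst B (i + 1)) 1)
        + tens B (Pi.single (cst B (i + 1)) 1 - Pi.single (cst B i) 1) (Pi.single (cst B (i + 1 + 1 + 1)) 1 - Pi.single (cst B (i + 1 + 1)) 1) = 0 := by
      rw [← tens_add_right, ← tens_add_right, ← tens_add_right]
      have hi : (i - 1 : ZMod 4) = i + 1 + 1 + 1 := by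
        rw [sub_eq_iff_eq_add]; exact e4.symm
      rw [hi]
      have z : (Pi.single (cst B i) 1 - Pi.single (cst B (i + 1 + 1 + 1)) 1 + (Pi.single (cst B (i + 1)) 1 - Pi.single (cst B i) 1)
          + (Pi.single (cst B (i + 1 + 1)) 1 - Pi.single (cst B (i + 1)) 1)
          + (Pi.single (cst B (i + 1 + 1 + 1)) 1 - Pi.single (cst B (i + 1 + 1)) 1) : Ty B → ℤ) = 0 := by
        abel
      rw [z, tens_zero_right]
    rw [add_comm] at cyc
    rw [eq_neg_of_add_eq_zero_left cyc]
    exact Submodule.neg_mem _ (Submodule.add_mem _ (Submodule.add_mem _ hY (Z i)) (U i))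
  -- dispatch on `j - v`
  obtain ⟨Δ, rfl⟩ : ∃ Δ, j = Δ + v := ⟨j - v, by rw [sub_add_cancel]⟩
  rcases (by decide : ∀ Δ : ZMod 4, Δ = 0 ∨ Δ = 1 ∨ Δ = 2 ∨ Δ = 3) Δ with h | h | h | h <;> subst h
  · rw [zero_add]; exact Z v
  · have := U v
    rw [show (1 : ZMod 4) + v + 1 = v + 1 + 1 by ring, show (1 : ZMod 4) + v = v + 1 by ring]
    exact this
  · have := V v
    rwa [show v + 1 + 1 + 1 = 2 + v + 1 by ring, show v + 1 + 1 = 2 + v by ring] at this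
  · have := Y (v - 1)
    have e : (3 : ZMod 4) + v + 1 = v := by rw [add_comm (3 : ZMod 4) v, add_assoc, show (3 : ZMod 4) + 1 = 0 by decide, add_zero]
    rw [e]
    rwa [sub_add_cancel, show v - 1 = 3 + v by rw [sub_eq_add_neg, show (-1 : ZMod 4) = 3 by decide, add_comm]] at this

omit [AddGroup B] [DecidableEq B] in
/-- `(e_{v+1} − e_v) ⊗ (e_{u′} − e_{u″}) ∈ N₂` for all constants, by telescoping. [folklore] -/
theorem dsq_mem {N₂ : Submodule ℤ (Ty₂ B → ℤ)}
    (hdd : ∀ v j : ZMod 4, tens B (Pi.single (cst B (v + 1)) 1 - Pi.single (cst B v) 1) (Pi.single (cst B (j + 1)) 1 - Pi.single (cst B j) 1) ∈ N₂)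
    (v u' u'' : ZMod 4) : tens B (Pi.single (cst B (v + 1)) 1 - Pi.single (cst B v) 1) (Pi.single (cst B u') 1 - Pi.single (cst B u'') 1) ∈ N₂ := by
  refine tele_right B (fun a => ?_) u' u''
  have h := hdd v a
  have e : tens B (Pi.single (cst B (v + 1)) 1 - Pi.single (cst B v) 1) (Pi.single (cst B a) 1 - Pi.single (cst B (a + 1)) 1)
      = -tens B (Pi.single (cst B (v + 1)) 1 - Pi.single (cst B v) 1) (Pi.single (cst B (a + 1)) 1 - Pi.single (cst B a) 1) := by
    rw [tens_sub_right, tens_sub_right, neg_sub]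
  rw [e]
  exact Submodule.neg_mem _ h

omit [AddGroup B] in
/-- **All Weil lifts of the first kind** `w_u ⊗ e_c ∈ N₂`: `w_u ⊗ (e_u − e_c) = Σ_b (e_{u−δ_b} − e_u) ⊗ (e_u − e_c) + (e_u − e_{u−1}) ⊗ (e_u − e_c)`.
[folklore] -/
theorem W0_mem {N₂ : Submodule ℤ (Ty₂ B → ℤ)}
    (hD0 : ∀ (u : ZMod 4) (b : B) (k : ZMod 4) (u' u'' : ZMod 4), (k = 1 ∨ k = -1) →
      tens B (Pi.single (atom B u b k) 1 - Pi.single (cst B u) 1) (Pi.single (cst B u') 1 - Pi.single (cst B u'') 1) ∈ N₂)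
    (hW : ∀ u : ZMod 4, tens B (Wvec B u) (Pi.single (cst B u) 1) ∈ N₂ ∧ tens B (Wvec B u) (Pi.single (cst B (u - 1)) 1) ∈ N₂)
    (hdsq : ∀ v u' u'' : ZMod 4, tens B (Pi.single (cst B (v + 1)) 1 - Pi.single (cst B v) 1) (Pi.single (cst B u') 1 - Pi.single (cst B u'') 1) ∈ N₂)
    (u c : ZMod 4) : tens B (Wvec B u) (Pi.single (cst B c) 1) ∈ N₂ := by
  have e : tens B (Wvec B u) (Pi.single (cst B c) 1)
      = tens B (Wvec B u) (Pi.single (cst B u) 1) - tens B (Wvec B u) (Pi.single (cst B u) 1 - Pi.single (cst B c) 1) := by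
    rw [tens_sub_right, sub_sub_cancel]
  have e2 : tens B (Wvec B u) (Pi.single (cst B u) 1 - Pi.single (cst B c) 1)
      = (∑ b : B, tens B (Pi.single (atom B u b (-1)) 1 - Pi.single (cst B u) 1) (Pi.single (cst B u) 1 - Pi.single (cst B c) 1))
        + tens B (Pi.single (cst B u) 1 - Pi.single (cst B (u - 1)) 1) (Pi.single (cst B u) 1 - Pi.single (cst B c) 1) := by
    rw [Wvec_eq_sum, tens_add_left, tens_sum_left]
  have hd := hdsq (u - 1) u c
  rw [sub_add_cancel] at hd
  rw [e, e2]
  exact Submodule.sub_mem _ (hW u).1 (Submodule.add_mem _ (Submodule.sum_mem _ fun b _ => hD0 u b (-1) u c (Or.inr rfl)) hd)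

/-- **All Weil lifts of the second kind** `e_c ⊗ w_u ∈ N₂`, by the swap-twist. [folklore] -/
theorem W1_mem {N₂ : Submodule ℤ (Ty₂ B → ℤ)} (hmot : ∀ v ∈ N₂, ∀ (e : Bool) (h : ZMod 4 × B), transl₂ B e h v ∈ N₂)
    (hW0 : ∀ u c : ZMod 4, tens B (Wvec B u) (Pi.single (cst B c) 1) ∈ N₂) (u c : ZMod 4) :
    tens B (Pi.single (cst B c) 1) (Wvec B u) ∈ N₂ := by
  have h := swap_mem B hmot (hW0 u (c - 1))
  rwa [transl_single_cst, sub_add_cancel] at h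

/-! ## §5 Assembly: the nine classes give the six families -/

/-- **THE CLOSING MOVES.**  In a motion-stable `N₂ ⊇ pairs₂`, the nine residual classes `hF1` (six mixed), `hF2` (column), `hF3` (two equatorial)
give all X-lifts, all Weil lifts and all D-moves, of both kinds — the six hypothesis families of the octic residual theorem. [folklore] -/
theorem closing_moves {N₂ : Submodule ℤ (Ty₂ B → ℤ)} (hmot : ∀ v ∈ N₂, ∀ (e : Bool) (h : ZMod 4 × B), transl₂ B e h v ∈ N₂)
    (hP : pairs₂ B ≤ N₂) {b₁ b₀ : B} {Q : Finset B}
    (hF1 : ∀ Δ k : ZMod 4, (Δ = 0 ∨ Δ = 1 ∨ Δ = 2) → (k = 1 ∨ k = -1) →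
      tens B (Pi.single (cst B 0) 1 - Pi.single (cst B 1) 1) (Pi.single (cst B Δ) 1 - Pi.single (atom B Δ b₁ k) 1) ∈ N₂)
    (hF2 : tens B (Xvec B 1 b₀ + pairVec B (cst B 0) - pairVec B (atom B 0 b₀ (-1))) (Pi.single (cst B 0) 1) ∈ N₂)
    (hF3 : ∀ c : ZMod 4, (c = 0 ∨ c = 1) → tens B ((∑ q ∈ Q, Xvec B 0 q) - Wvec B 1) (Pi.single (cst B c) 1) ∈ N₂) :
    (∀ (u : ZMod 4) (b : B) (u' : ZMod 4), tens B (Xvec B u b) (Pi.single (cst B u') 1) ∈ N₂) ∧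
    (∀ (u : ZMod 4) (b : B) (u' : ZMod 4), tens B (Pi.single (cst B u') 1) (Xvec B u b) ∈ N₂) ∧
    (∀ u u' : ZMod 4, tens B (Wvec B u) (Pi.single (cst B u') 1) ∈ N₂) ∧
    (∀ u u' : ZMod 4, tens B (Pi.single (cst B u') 1) (Wvec B u) ∈ N₂) ∧
    (∀ (u : ZMod 4) (b : B) (k : ZMod 4) (u' u'' : ZMod 4), (k = 1 ∨ k = -1) →
      tens B (Pi.single (atom B u b k) 1 - Pi.single (cst B u) 1) (Pi.single (cst B u') 1 - Pi.single (cst B u'') 1) ∈ N₂) ∧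
    (∀ (u : ZMod 4) (b : B) (k : ZMod 4) (u' u'' : ZMod 4), (k = 1 ∨ k = -1) →
      tens B (Pi.single (cst B u') 1 - Pi.single (cst B u'') 1) (Pi.single (atom B u b k) 1 - Pi.single (cst B u) 1) ∈ N₂) := by
  have hD0 := D0_mem B hmot hF1
  have hD1 := D1_mem B hmot hF1
  have hX0 : ∀ (u : ZMod 4) (b : B) (u' : ZMod 4), tens B (Xvec B u b) (Pi.single (cst B u') 1) ∈ N₂ :=
    X0_mem B hmot (X_col_mem B hD0 (X_base_mem B hP hD0 hF2))
  have hW : ∀ u : ZMod 4, tens B (Wvec B u) (Pi.single (cst B u) 1) ∈ N₂ ∧ tens B (Wvec B u) (Pi.single (cst B (u - 1)) 1) ∈ N₂ :=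
    W_diag_mem B hmot (W_base_mem B hX0 (hF3 0 (Or.inl rfl))) (W_base_mem B hX0 (hF3 1 (Or.inr rfl)))
  have hW0 : ∀ u c : ZMod 4, tens B (Wvec B u) (Pi.single (cst B c) 1) ∈ N₂ :=
    W0_mem B hD0 hW (dsq_mem B (dd_mem B hP (ZY_mem B hmot hD0 hW)))
  exact ⟨hX0, X1_mem B hmot hX0, hW0, W1_mem B hmot hW0, hD0, hD1⟩

end Summit.HodgeConjecture.CorCM.Census.OcticTwist
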